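import Mathlib

/-!
# PneNP / OverlapGapAlgebra — `SearchHardWindow` / `SolvableImpliesStableSection`:
# SEQUENTIAL LOCAL RULES (index-order decimation) are ℓ²-stable (1/4) — increasing chains

Support for cruxes `stmt-PneNP-2460` (`SearchHardWindow`) and `stmt-PneNP-2463`
(`SolvableImpliesStableSection`). First file of the SEQUENTIAL LOCAL rung: a search map
`g : instances → assignments` on `F_k(n, m)` (instances `Φ : Fin m → Fin k → Fin n × Bool`) is an
INDEX-ORDER DECIMATION RULE WITH UNIT LOOK-AHEAD if its bit at variable `v` is an arbitrary
(label-dependent) function of the labelled clauses containing `v` and of ITS OWN BITS at the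
smaller variables `u < v` occurring in those clauses (Unit-Clause-style rules run in a fixed
variable order, one-round message-passing-guided decimation, the radius-one "sequential local
algorithms" of Gamarnik–Sudan). Changing one literal of clause `a` can then move the output only
inside the INCREASING CONE of the variables of `a`: the set of variables reached from them by
chains `x₀ < x₁ < ⋯ < x_ℓ` of co-occurring variables with increasing labels (file 3/4). This file
is the elementary combinatorics of such chains, definition-free (a chain is a sequence
`xx : ℕ → Fin n` with consecutive entries increasing and co-occurring in a clause of the allowed
set `A`):

* `shwSeq_reach_refl`, `shwSeq_reach_cons`, `shwSeq_reach_snoc`, `shwSeq_reach_mono`,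
  `shwSeq_reach_le`, `shwSeq_reach_congr`, `shwSeq_reach_update_slot` — closure properties, and
  invariance under rewriting a clause outside `A` or a slot holding a label below the root;
* `shwSeq_reach_split` — LAST USE of a clause `c`: a chain from `v` either avoids `c`, or `c`
  holds two labels `x ≥ v`, `x < u` with `u` chained to the target avoiding `c`;
* `shwSeq_reach_cases` — hence the first-hop decomposition with the continuation AVOIDING the
  first clause, the set inclusion behind the second-moment recursion of file 2/4.
No definitions; axioms `propext`, `Classical.choice`, `Quot.sound`.
-/

set_option linter.dupNamespace false -- `Summit.PneNP.PneNP.…`: summit = sub-problem (D-0017)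

namespace Summit.PneNP.PneNP.Theorems

open Finset
open scoped Classical

section SeqReach

variable {m k n : ℕ}

/-- Labels increase along a chain. -/
theorem shwSeq_chain_mono (xx : ℕ → Fin n) (ll : ℕ)
    (h : ∀ ss : ℕ, ss < ll → xx ss < xx (ss + 1)) :
    ∀ s t : ℕ, s ≤ t → t ≤ ll → xx s ≤ xx t := by
  intro s t hst htl
  induction t with
  | zero =>
    have : s = 0 := Nat.le_zero.mp hst
    subst this; exact le_rfl
  | succ t ih =>
    rcases Nat.lt_or_eq_of_le hst with hlt | heq
    · have h1 : xx s ≤ xx t := ih (Nat.lt_succ_iff.mp hlt) (Nat.le_of_succ_le htl)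
      have h2 : xx t < xx (t + 1) := h t (Nat.lt_of_succ_le htl)
      exact le_trans h1 (le_of_lt h2)
    · subst heq; exact le_rfl

/-- A suffix of a chain is a chain (with the allowed clause set read off the suffix). -/
theorem shwSeq_chain_shift (Φ : (Fin m → Fin k → Fin n × Bool)) (A : Finset (Fin m)) (L : ℕ) (x : ℕ → Fin n)
    (s : ℕ) (hs : s ≤ L)
    (hstep : ∀ t : ℕ, t < L → s ≤ t → (x t < x (t + 1) ∧ ∃ c ∈ A, ∃ p q : Fin k,
      (Φ c p).1 = x t ∧ (Φ c q).1 = x (t + 1))) :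
    (∃ (ll : ℕ) (xx : ℕ → Fin n), xx 0 = (x s) ∧ xx ll = (x L) ∧ ∀ ss : ℕ, ss < ll →
          (xx ss < xx (ss + 1) ∧ ∃ cc ∈ A, ∃ pp qq : Fin k,
            (Φ cc pp).1 = xx ss ∧ (Φ cc qq).1 = xx (ss + 1))) := by
  refine ⟨L - s, fun t => x (s + t), ?_, ?_, ?_⟩
  · dsimp only; rw [Nat.add_zero]
  · dsimp only; rw [Nat.add_sub_cancel' hs]
  · intro t ht
    dsimp only
    have h1 : s + t < L := by omega
    have h2 : s ≤ s + t := Nat.le_add_right s t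
    have h3 : s + (t + 1) = s + t + 1 := by omega
    obtain ⟨hlt, c, hc, p, q, hp, hq⟩ := hstep (s + t) h1 h2
    rw [h3]
    exact ⟨hlt, c, hc, p, q, hp, hq⟩

/-- The trivial chain. -/
theorem shwSeq_reach_refl (Φ : (Fin m → Fin k → Fin n × Bool)) (A : Finset (Fin m)) (v : Fin n) :
    (∃ (ll : ℕ) (xx : ℕ → Fin n), xx 0 = v ∧ xx ll = v ∧ ∀ ss : ℕ, ss < ll →
          (xx ss < xx (ss + 1) ∧ ∃ cc ∈ A, ∃ pp qq : Fin k,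
            (Φ cc pp).1 = xx ss ∧ (Φ cc qq).1 = xx (ss + 1))) :=
  ⟨0, fun _ => v, rfl, rfl, fun ss hss => absurd hss (Nat.not_lt_zero ss)⟩

/-- Prepending a hop. -/
theorem shwSeq_reach_cons (Φ : (Fin m → Fin k → Fin n × Bool)) (A : Finset (Fin m)) (v u w : Fin n) (c : Fin m)
    (p q : Fin k) (hvu : v < u) (hc : c ∈ A) (hp : (Φ c p).1 = v) (hq : (Φ c q).1 = u)
    (h : (∃ (ll : ℕ) (xx : ℕ → Fin n), xx 0 = u ∧ xx ll = w ∧ ∀ ss : ℕ, ss < ll →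
          (xx ss < xx (ss + 1) ∧ ∃ cc ∈ A, ∃ pp qq : Fin k,
            (Φ cc pp).1 = xx ss ∧ (Φ cc qq).1 = xx (ss + 1)))) : (∃ (ll : ℕ) (xx : ℕ → Fin n), xx 0 = v ∧ xx ll = w ∧ ∀ ss : ℕ, ss < ll →
          (xx ss < xx (ss + 1) ∧ ∃ cc ∈ A, ∃ pp qq : Fin k,
            (Φ cc pp).1 = xx ss ∧ (Φ cc qq).1 = xx (ss + 1))) := by
  obtain ⟨L, x, h0, hl, hstep⟩ := h
  refine ⟨L + 1, fun t => if t = 0 then v else x (t - 1), by simp, by simp [hl], ?_⟩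
  intro ss hss
  rcases Nat.eq_zero_or_pos ss with h0s | hpos
  · subst h0s
    simp only [if_true, Nat.zero_add, one_ne_zero, if_false, Nat.sub_self, h0]
    exact ⟨hvu, c, hc, p, q, hp, hq⟩
  · have hne : ss ≠ 0 := Nat.pos_iff_ne_zero.mp hpos
    have hne' : ss + 1 ≠ 0 := Nat.succ_ne_zero ss
    simp only [hne, if_false, hne']
    have hss' : ss - 1 < L := by omega
    have heq : ss + 1 - 1 = ss - 1 + 1 := by omega
    obtain ⟨hlt, cc, hcc, pp, qq, hpp, hqq⟩ := hstep (ss - 1) hss'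
    rw [heq]
    exact ⟨hlt, cc, hcc, pp, qq, hpp, hqq⟩

/-- Appending a hop. -/
theorem shwSeq_reach_snoc (Φ : (Fin m → Fin k → Fin n × Bool)) (A : Finset (Fin m)) (v u w : Fin n) (c : Fin m)
    (p q : Fin k) (h : (∃ (ll : ℕ) (xx : ℕ → Fin n), xx 0 = v ∧ xx ll = u ∧ ∀ ss : ℕ, ss < ll →
          (xx ss < xx (ss + 1) ∧ ∃ cc ∈ A, ∃ pp qq : Fin k,
            (Φ cc pp).1 = xx ss ∧ (Φ cc qq).1 = xx (ss + 1)))) (huw : u < w) (hc : c ∈ A) (hp : (Φ c p).1 = u)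
    (hq : (Φ c q).1 = w) : (∃ (ll : ℕ) (xx : ℕ → Fin n), xx 0 = v ∧ xx ll = w ∧ ∀ ss : ℕ, ss < ll →
          (xx ss < xx (ss + 1) ∧ ∃ cc ∈ A, ∃ pp qq : Fin k,
            (Φ cc pp).1 = xx ss ∧ (Φ cc qq).1 = xx (ss + 1))) := by
  obtain ⟨L, x, h0, hl, hstep⟩ := h
  refine ⟨L + 1, fun t => if t ≤ L then x t else w, by simp [h0], by simp, ?_⟩
  intro ss hss
  rcases Nat.lt_or_eq_of_le (Nat.lt_succ_iff.mp hss) with hlt | heq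
  · have h1 : ss ≤ L := le_of_lt hlt
    have h2 : ss + 1 ≤ L := hlt
    simp only [h1, if_true, h2]
    exact hstep ss hlt
  · subst heq
    have h2 : ¬ (ss + 1 ≤ ss) := Nat.not_succ_le_self ss
    simp only [le_refl, if_true, h2, if_false, hl]
    exact ⟨huw, c, hc, p, q, hp, hq⟩

/-- Monotonicity in the allowed clause set. -/
theorem shwSeq_reach_mono (Φ : (Fin m → Fin k → Fin n × Bool)) (A A' : Finset (Fin m)) (hAA : A ⊆ A') (v w : Fin n)
    (h : (∃ (ll : ℕ) (xx : ℕ → Fin n), xx 0 = v ∧ xx ll = w ∧ ∀ ss : ℕ, ss < ll →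
          (xx ss < xx (ss + 1) ∧ ∃ cc ∈ A, ∃ pp qq : Fin k,
            (Φ cc pp).1 = xx ss ∧ (Φ cc qq).1 = xx (ss + 1)))) : (∃ (ll : ℕ) (xx : ℕ → Fin n), xx 0 = v ∧ xx ll = w ∧ ∀ ss : ℕ, ss < ll →
          (xx ss < xx (ss + 1) ∧ ∃ cc ∈ A', ∃ pp qq : Fin k,
            (Φ cc pp).1 = xx ss ∧ (Φ cc qq).1 = xx (ss + 1))) := by
  obtain ⟨L, x, h0, hl, hstep⟩ := h
  refine ⟨L, x, h0, hl, fun ss hss => ?_⟩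
  obtain ⟨hlt, cc, hcc, pp, qq, hp, hq⟩ := hstep ss hss
  exact ⟨hlt, cc, hAA hcc, pp, qq, hp, hq⟩

/-- The target of a chain is at least its root. -/
theorem shwSeq_reach_le (Φ : (Fin m → Fin k → Fin n × Bool)) (A : Finset (Fin m)) (v w : Fin n)
    (h : (∃ (ll : ℕ) (xx : ℕ → Fin n), xx 0 = v ∧ xx ll = w ∧ ∀ ss : ℕ, ss < ll →
          (xx ss < xx (ss + 1) ∧ ∃ cc ∈ A, ∃ pp qq : Fin k,
            (Φ cc pp).1 = xx ss ∧ (Φ cc qq).1 = xx (ss + 1)))) : v ≤ w := by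
  obtain ⟨L, x, h0, hl, hstep⟩ := h
  rw [← h0, ← hl]
  exact shwSeq_chain_mono x L (fun ss hss => (hstep ss hss).1) 0 L (Nat.zero_le _) le_rfl

/-- Chains only read the allowed clauses. -/
theorem shwSeq_reach_congr (Φ Φ' : (Fin m → Fin k → Fin n × Bool)) (A : Finset (Fin m)) (hΦ : ∀ c ∈ A, Φ' c = Φ c)
    (v w : Fin n) (h : (∃ (ll : ℕ) (xx : ℕ → Fin n), xx 0 = v ∧ xx ll = w ∧ ∀ ss : ℕ, ss < ll →
          (xx ss < xx (ss + 1) ∧ ∃ cc ∈ A, ∃ pp qq : Fin k,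
            (Φ cc pp).1 = xx ss ∧ (Φ cc qq).1 = xx (ss + 1)))) : (∃ (ll : ℕ) (xx : ℕ → Fin n), xx 0 = v ∧ xx ll = w ∧ ∀ ss : ℕ, ss < ll →
          (xx ss < xx (ss + 1) ∧ ∃ cc ∈ A, ∃ pp qq : Fin k,
            (Φ' cc pp).1 = xx ss ∧ (Φ' cc qq).1 = xx (ss + 1))) := by
  obtain ⟨L, x, h0, hl, hstep⟩ := h
  refine ⟨L, x, h0, hl, fun ss hss => ?_⟩
  obtain ⟨hlt, cc, hcc, pp, qq, hp, hq⟩ := hstep ss hss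
  exact ⟨hlt, cc, hcc, pp, qq, by rw [hΦ cc hcc]; exact hp, by rw [hΦ cc hcc]; exact hq⟩

/-- Chains from `v` never read a slot holding a label below `v`: rewriting such a slot keeps
every chain. -/
theorem shwSeq_reach_update_slot (Φ : (Fin m → Fin k → Fin n × Bool)) (A : Finset (Fin m)) (v w : Fin n) (c : Fin m)
    (j : Fin k) (ℓ : Fin n × Bool) (hcj : (Φ c j).1 < v) (h : (∃ (ll : ℕ) (xx : ℕ → Fin n), xx 0 = v ∧ xx ll = w ∧ ∀ ss : ℕ, ss < ll →
          (xx ss < xx (ss + 1) ∧ ∃ cc ∈ A, ∃ pp qq : Fin k,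
            (Φ cc pp).1 = xx ss ∧ (Φ cc qq).1 = xx (ss + 1)))) :
    (∃ (ll : ℕ) (xx : ℕ → Fin n), xx 0 = v ∧ xx ll = w ∧ ∀ ss : ℕ, ss < ll →
          (xx ss < xx (ss + 1) ∧ ∃ cc ∈ A, ∃ pp qq : Fin k,
            ((Function.update Φ c (Function.update (Φ c) j ℓ)) cc pp).1 = xx ss ∧ ((Function.update Φ c (Function.update (Φ c) j ℓ)) cc qq).1 = xx (ss + 1))) := by
  obtain ⟨L, x, h0, hl, hstep⟩ := h
  have hmono := shwSeq_chain_mono x L (fun ss hss => (hstep ss hss).1)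
  -- a slot holding a label `≥ v` is not the rewritten slot
  have hread : ∀ (c' : Fin m) (p : Fin k), v ≤ (Φ c' p).1 →
      (Function.update Φ c (Function.update (Φ c) j ℓ)) c' p = Φ c' p := by
    intro c' p hv
    by_cases hc' : c' = c
    · subst hc'
      rw [Function.update_self]
      have hpj : p ≠ j := by
        rintro rfl
        exact absurd (lt_of_lt_of_le hcj hv) (lt_irrefl _)
      rw [Function.update_of_ne hpj]
    · rw [Function.update_of_ne hc']
  refine ⟨L, x, h0, hl, fun ss hss => ?_⟩
  obtain ⟨hlt, cc, hcc, pp, qq, hp, hq⟩ := hstep ss hss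
  have hv1 : v ≤ (Φ cc pp).1 := by
    rw [hp, ← h0]; exact hmono 0 ss (Nat.zero_le _) (le_of_lt hss)
  have hv2 : v ≤ (Φ cc qq).1 := by
    rw [hq, ← h0]; exact hmono 0 (ss + 1) (Nat.zero_le _) hss
  exact ⟨hlt, cc, hcc, pp, qq, by rw [hread cc pp hv1]; exact hp, by rw [hread cc qq hv2]; exact hq⟩

/-- **Last use of a clause.** A chain from `v` to `w` either avoids the clause `c` altogether,
or `c` holds a label `x ≥ v` (on the chain) and a larger label `u` from which `w` is reached by
a chain AVOIDING `c` (cut the chain at the last hop that `c` can witness). -/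
theorem shwSeq_reach_split (Φ : (Fin m → Fin k → Fin n × Bool)) (A : Finset (Fin m)) (v w : Fin n) (c : Fin m)
    (h : (∃ (ll : ℕ) (xx : ℕ → Fin n), xx 0 = v ∧ xx ll = w ∧ ∀ ss : ℕ, ss < ll →
          (xx ss < xx (ss + 1) ∧ ∃ cc ∈ A, ∃ pp qq : Fin k,
            (Φ cc pp).1 = xx ss ∧ (Φ cc qq).1 = xx (ss + 1)))) :
    (∃ (ll : ℕ) (xx : ℕ → Fin n), xx 0 = v ∧ xx ll = w ∧ ∀ ss : ℕ, ss < ll →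
          (xx ss < xx (ss + 1) ∧ ∃ cc ∈ (A.erase c), ∃ pp qq : Fin k,
            (Φ cc pp).1 = xx ss ∧ (Φ cc qq).1 = xx (ss + 1))) ∨
      ∃ p q : Fin k, v ≤ (Φ c p).1 ∧ (Φ c p).1 < (Φ c q).1 ∧ (∃ (ll : ℕ) (xx : ℕ → Fin n), xx 0 = ((Φ c q).1) ∧ xx ll = w ∧ ∀ ss : ℕ, ss < ll →
          (xx ss < xx (ss + 1) ∧ ∃ cc ∈ (A.erase c), ∃ pp qq : Fin k,
            (Φ cc pp).1 = xx ss ∧ (Φ cc qq).1 = xx (ss + 1))) := by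
  obtain ⟨L, x, h0, hl, hstep⟩ := h
  have hmono := shwSeq_chain_mono x L (fun ss hss => (hstep ss hss).1)
  set P : ℕ → Prop := fun s => s < L ∧ ∃ p q : Fin k, (Φ c p).1 = x s ∧ (Φ c q).1 = x (s + 1)
    with hP
  by_cases hex : ∃ s, P s
  · -- cut at the last hop witnessed by `c`
    right
    obtain ⟨s₁, hs₁⟩ := hex
    set s₀ := Nat.findGreatest P L with hs₀
    have hPs₀ : P s₀ := Nat.findGreatest_spec (le_of_lt hs₁.1) hs₁
    have hmax : ∀ t, s₀ < t → t ≤ L → ¬ P t := fun t ht htl =>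
      Nat.findGreatest_is_greatest ht htl
    obtain ⟨hs₀l, p, q, hp, hq⟩ := hPs₀
    refine ⟨p, q, ?_, ?_, ?_⟩
    · rw [hp, ← h0]; exact hmono 0 s₀ (Nat.zero_le _) (le_of_lt hs₀l)
    · rw [hp, hq]; exact (hstep s₀ hs₀l).1
    · rw [hq, ← hl]
      refine shwSeq_chain_shift Φ (A.erase c) L x (s₀ + 1) hs₀l ?_
      intro ss hss hle
      obtain ⟨hlt, cc, hcc, pp, qq, hpp, hqq⟩ := hstep ss hss
      refine ⟨hlt, cc, Finset.mem_erase.2 ⟨?_, hcc⟩, pp, qq, hpp, hqq⟩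
      rintro rfl
      exact hmax ss (Nat.lt_of_succ_le hle) (le_of_lt hss) ⟨hss, pp, qq, hpp, hqq⟩
  · -- no hop is witnessed by `c`: the same chain avoids `c`
    left
    push Not at hex
    refine ⟨L, x, h0, hl, fun ss hss => ?_⟩
    obtain ⟨hlt, cc, hcc, pp, qq, hpp, hqq⟩ := hstep ss hss
    refine ⟨hlt, cc, Finset.mem_erase.2 ⟨?_, hcc⟩, pp, qq, hpp, hqq⟩
    rintro rfl
    exact hex ss ⟨hss, pp, qq, hpp, hqq⟩

/-- **First-hop decomposition with an avoiding continuation.** If `w` is reached from `v`, then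
`w = v` or some allowed clause `c` holds `v` and a larger label `u` from which `w` is reached by a
chain avoiding `c`. -/
theorem shwSeq_reach_cases (Φ : (Fin m → Fin k → Fin n × Bool)) (A : Finset (Fin m)) (v w : Fin n)
    (h : (∃ (ll : ℕ) (xx : ℕ → Fin n), xx 0 = v ∧ xx ll = w ∧ ∀ ss : ℕ, ss < ll →
          (xx ss < xx (ss + 1) ∧ ∃ cc ∈ A, ∃ pp qq : Fin k,
            (Φ cc pp).1 = xx ss ∧ (Φ cc qq).1 = xx (ss + 1)))) :
    w = v ∨ ∃ c ∈ A, ∃ p q : Fin k, (Φ c p).1 = v ∧ v < (Φ c q).1 ∧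
      (∃ (ll : ℕ) (xx : ℕ → Fin n), xx 0 = ((Φ c q).1) ∧ xx ll = w ∧ ∀ ss : ℕ, ss < ll →
          (xx ss < xx (ss + 1) ∧ ∃ cc ∈ (A.erase c), ∃ pp qq : Fin k,
            (Φ cc pp).1 = xx ss ∧ (Φ cc qq).1 = xx (ss + 1))) := by
  obtain ⟨L, x, h0, hl, hstep⟩ := h
  rcases Nat.eq_zero_or_pos L with hll | hll
  · left; rw [← hl, hll, h0]
  · right
    obtain ⟨hlt0, c₀, hc₀, p₀, q₀, hp₀, hq₀⟩ := hstep 0 hll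
    rw [h0] at hp₀ hlt0
    simp only [Nat.zero_add] at hq₀ hlt0
    -- the tail chain from `x 1`
    have htail : (∃ (ll : ℕ) (xx : ℕ → Fin n), xx 0 = (x 1) ∧ xx ll = w ∧ ∀ ss : ℕ, ss < ll →
          (xx ss < xx (ss + 1) ∧ ∃ cc ∈ A, ∃ pp qq : Fin k,
            (Φ cc pp).1 = xx ss ∧ (Φ cc qq).1 = xx (ss + 1))) := by
      rw [← hl]
      exact shwSeq_chain_shift Φ A L x 1 hll (fun ss hss _ => hstep ss hss)
    rcases shwSeq_reach_split Φ A (x 1) w c₀ htail with hav | ⟨p, q, h1p, hpq, hreach⟩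
    · exact ⟨c₀, hc₀, p₀, q₀, hp₀, by rw [hq₀]; exact hlt0, by rw [hq₀]; exact hav⟩
    · exact ⟨c₀, hc₀, p₀, q, hp₀, lt_of_lt_of_le hlt0 (le_trans h1p (le_of_lt hpq)), hreach⟩

end SeqReach

end Summit.PneNP.PneNP.Theorems
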